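import Mathlib.Analysis.PSeries
import Summits.QuantumFields.BalabanUV.Beta.EriceFlowEnclosureWeightedTauberianSeq

/-!
# Beta / EriceFlowEnclosureLogMeanSeq — THE LOGARITHMIC CUTOFF AVERAGE `(Σ_{n<N} a n∕(n+1))∕(Σ_{n<N} 1∕(n+1))`: REGULAR, WEAKER THAN (C,1)
# (`n⁻¹·Σ_{i<n} a i → m ⟹ ℓ-mean → m`, Abel summation), AND ITS MASS `H_N ∼ log N` VIOLATES P2 #54c's GROWTH CONDITION (G)
# (pure [folklore] SERVICE for the BARE ∕ CUTOFF side of rows L131–L142; imports P2 #54c and Mathlib's divergence of the harmonic series).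
#   §1 THE LOGARITHMIC WEIGHTS `p n = (n+1)⁻¹` — mass `H_N = Σ_{n<N} (n+1)⁻¹ → ∞` (Mathlib), regularity `a → m ⟹ ℓ-mean → m` (P2 #54c
#      `weightedMean_of_tendsto`), the window increment `H_{2N} − H_N ≤ 1`, and **`not_growth_logMass`: (G) FAILS** (at q = 2: `ρ·H_N ≤ H_{2N} ≤ H_N + 1`
#      would bound `H_N`), so P2 #54c's Tauberian theorem does NOT cover the logarithmic method — and indeed its conclusion fails there (P2 #54f);
#   §2 THE INCLUSION (C,1) ⊂ (ℓ) — the Abel-summation identity **`Σ_{n<N} a n∕(n+1) = σ_N + Σ_{k<N} σ_k∕(k+1)`** (`σ_k = k⁻¹·Σ_{i<k} a i`;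
#      `logSum_eq_cesaro`, by induction) and **`logMean_of_cesaro`: `σ_N → m ⟹ ℓ-mean → m`** (the second term is the ℓ-mean OF the Cesàro means,
#      regular; the first is `σ_N∕H_N → 0`); with P2 #53a: in (SO), `a → m ⟺ σ → m ⟹ ℓ-mean → m` (`logMean_of_tendsto'`).
# (β-flow team, prover 2 = lower ∕ positivity side, unit `b2b-balaban-beta-bflow-p2`, gen 37; module P2 #54e; no Erice sentence occurs)

HONEST FRAMING (page 1 of everything the β sub-cell writes): discharging `BetaPertH` makes Bałaban's UV stability UNCONDITIONAL — a
real constructive-QFT result; it is NOT the continuum limit and NOT the Clay problem.  HONEST DEPENDENCY (cell reorg 2026-08-19,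
verbatim): «continuum YM on T⁴ ⇐ BetaPertH ∧ nine spine estimates (0/9 proved); BetaPertH ⇐ (D1) ∧ (D4) ∧ CAP+tail; G-an2-4 gates
asym, D1 and NE2/3/4.»  THIS MODULE DISCHARGES NOTHING and quotes nothing: [folklore] real analysis about real sequences (the logarithmic method
`(ℓ)` = `(N̄, 1∕(n+1))`: Hardy, Divergent Series (1949) §3.8 Thm 14, §4.16 and the inclusion (C,1) ⊂ ℓ; the Tauberian theory of ℓ is Kwee 1967 ∕
Móricz 2013, IN THE TREE as `Literature.Analysis.Asymptotics.Moricz2013_corollary3_holds`, used in P2 #54f).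

THE POINT.  `a n = A_{n+1} − A_n` with `A_k = k·σ_k` turns `Σ_{n<N} a n∕(n+1)` into `σ_N + Σ_{k<N} σ_k∕(k+1)`: the logarithmic mean of a is the
logarithmic mean of its Cesàro means plus `σ_N∕H_N`.  Hence every Cesàro limit is a logarithmic limit (and every Abel limit of a bounded-below
sequence, P2 #54b); the converse needs a Tauberian condition on the POWER scales N → N^λ because the mass log N is slowly varying: across a
window [N, 2N] it gains at most 1 while (G) would ask for a fixed FACTOR.

WHAT THIS FILE PROVES (0 sorry, 0 def): §1 `logWeight_nonneg`, `logMass_tendsto_atTop`, `logMass_pos`, **`logMean_of_tendsto`**, `logMass_double_sub_le`,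
**`not_growth_logMass`**; §2 `logSum_eq_cesaro`, **`logMean_of_cesaro`**, `logMean_of_tendsto'`.
NOT CLAIMED: the Tauberian converse (false in the ordinary class — P2 #54f's witness; true on the power scales — Móricz, by name in P2 #54f); rates
(`H_N = log N + γ + O(1∕N)` is not used); anything about β-functions (P2 #54g); `BetaPertH`; continuum; Clay.
-/

namespace Summit.QuantumFields.BalabanUV.Beta.EriceFlowEnclosureLogMeanSeq

open Finset Filter Topology
open Summit.QuantumFields.BalabanUV.Beta.EriceFlowEnclosureCesaroTauberianSeq
open Summit.QuantumFields.BalabanUV.Beta.EriceFlowEnclosureWeightedTauberianSeq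

noncomputable section

variable {a : ℕ → ℝ}

/-! ## §1 The logarithmic weights: divergent mass, regularity, failure of (G) -/

/-- The logarithmic weights are nonnegative. [folklore] -/
theorem logWeight_nonneg (n : ℕ) : 0 ≤ ((n : ℝ) + 1)⁻¹ := by positivity

/-- THE LOGARITHMIC MASS DIVERGES: `H_N = Σ_{n<N} (n+1)⁻¹ → ∞` (Mathlib's divergence of the harmonic series). [folklore] -/
theorem logMass_tendsto_atTop : Tendsto (fun N => ∑ n ∈ range N, ((n : ℝ) + 1)⁻¹) atTop atTop :=
  Real.tendsto_sum_range_one_div_nat_succ_atTop.congr fun _ => sum_congr rfl fun _ _ => one_div _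

/-- `0 < H_N` for N ≥ 1. [folklore] -/
theorem logMass_pos {N : ℕ} (hN : 1 ≤ N) : 0 < ∑ n ∈ range N, ((n : ℝ) + 1)⁻¹ :=
  sum_pos (fun n _ => by positivity) (nonempty_range_iff.mpr (by omega))

/-- **REGULARITY OF THE LOGARITHMIC MEAN**: `a n → m ⟹ (Σ_{n<N} a n∕(n+1))∕H_N → m` (P2 #54c `weightedMean_of_tendsto`). [folklore] -/
theorem logMean_of_tendsto {m : ℝ} (ha : Tendsto a atTop (𝓝 m)) :
    Tendsto (fun N => (∑ n ∈ range N, ((n : ℝ) + 1)⁻¹ * a n) / ∑ n ∈ range N, ((n : ℝ) + 1)⁻¹) atTop (𝓝 m) :=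
  weightedMean_of_tendsto logWeight_nonneg logMass_tendsto_atTop ha

/-- THE MASS GAINED ACROSS A DOUBLING WINDOW IS AT MOST ONE: `H_{2N} − H_N = Σ_{N≤n<2N} (n+1)⁻¹ ≤ N·(N+1)⁻¹ ≤ 1`. [folklore] -/
theorem logMass_double_sub_le (N : ℕ) :
    ∑ n ∈ range (2 * N), ((n : ℝ) + 1)⁻¹ - ∑ n ∈ range N, ((n : ℝ) + 1)⁻¹ ≤ 1 := by
  have hN2 : N ≤ 2 * N := by omega
  rw [← sum_Ico_eq_sub _ hN2]
  have h1 : ∑ n ∈ Ico N (2 * N), ((n : ℝ) + 1)⁻¹ ≤ ∑ _n ∈ Ico N (2 * N), ((N : ℝ) + 1)⁻¹ := by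
    refine sum_le_sum fun n hn => ?_
    have h : (N : ℝ) + 1 ≤ (n : ℝ) + 1 := by
      have := (mem_Ico.mp hn).1; exact_mod_cast Nat.add_le_add_right this 1
    exact inv_anti₀ (by positivity) h
  have h2 : ∑ _n ∈ Ico N (2 * N), ((N : ℝ) + 1)⁻¹ = (N : ℝ) * ((N : ℝ) + 1)⁻¹ := by
    rw [sum_const, Nat.card_Ico, nsmul_eq_mul, show 2 * N - N = N by omega]
  have h3 : (N : ℝ) * ((N : ℝ) + 1)⁻¹ ≤ 1 := by
    rw [← div_eq_mul_inv, div_le_one (by positivity)]; linarith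
  linarith

/-- **THE LOGARITHMIC MASS VIOLATES THE GROWTH CONDITION (G) of P2 #54c**: there is no ρ > 1 with `ρ·H_N ≤ H_J` for all large N and J ≥ 2N,
since `H_{2N} ≤ H_N + 1` would then bound the divergent `H_N` by `1∕(ρ − 1)`.  So the weighted Tauberian theorem does not reach the
logarithmic method — and its conclusion indeed fails there (P2 #54f). [folklore] -/
theorem not_growth_logMass :
    ¬ (∀ q > (1:ℝ), ∃ ρ > (1:ℝ), ∃ N₁ : ℕ, ∀ N J : ℕ, N₁ ≤ N → q * N ≤ (J : ℝ) →
      ρ * (∑ n ∈ range N, ((n : ℝ) + 1)⁻¹) ≤ ∑ n ∈ range J, ((n : ℝ) + 1)⁻¹) := by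
  intro hG
  obtain ⟨ρ, hρ, N₁, h⟩ := hG 2 (by norm_num)
  have hρ1 : 0 < ρ - 1 := by linarith
  obtain ⟨N₂, hN₂⟩ := tendsto_atTop_atTop.mp logMass_tendsto_atTop (2 / (ρ - 1))
  set M : ℕ := max N₁ N₂ with hM
  have h1 := h M (2 * M) (le_max_left _ _) (by push_cast; exact le_rfl)
  have h2 := logMass_double_sub_le M
  have h3 : 2 / (ρ - 1) ≤ ∑ n ∈ range M, ((n : ℝ) + 1)⁻¹ := hN₂ M (le_max_right _ _)
  rw [div_le_iff₀ hρ1] at h3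
  nlinarith

/-! ## §2 The inclusion (C,1) ⊂ (ℓ) by Abel summation -/

/-- **THE ABEL-SUMMATION IDENTITY**: with `σ_k = k⁻¹·Σ_{i<k} a i` (σ_0 = 0),
**`Σ_{n<N} a n∕(n+1) = σ_N + Σ_{k<N} σ_k∕(k+1)`** — by induction on N: both sides gain `a N∕(N+1)`, because
`σ_{N+1} − σ_N + σ_N∕(N+1) = (A_{N+1} − A_N)∕(N+1)`. [folklore] -/
theorem logSum_eq_cesaro (a : ℕ → ℝ) (N : ℕ) :
    ∑ n ∈ range N, ((n : ℝ) + 1)⁻¹ * a n =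
      (N : ℝ)⁻¹ * ∑ i ∈ range N, a i + ∑ k ∈ range N, ((k : ℝ) + 1)⁻¹ * ((k : ℝ)⁻¹ * ∑ i ∈ range k, a i) := by
  induction N with
  | zero => simp
  | succ N ih =>
    rw [sum_range_succ, ih, sum_range_succ (fun k => ((k : ℝ) + 1)⁻¹ * ((k : ℝ)⁻¹ * ∑ i ∈ range k, a i)),
      sum_range_succ a]
    push_cast
    rcases Nat.eq_zero_or_pos N with hN | hN
    · subst hN; simp
    · have hN0 : (N : ℝ) ≠ 0 := Nat.cast_ne_zero.mpr (Nat.pos_iff_ne_zero.mp hN)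
      have hN1 : (N : ℝ) + 1 ≠ 0 := by positivity
      field_simp
      ring

/-- **THE INCLUSION (C,1) ⊂ (ℓ)**: `n⁻¹·Σ_{i<n} a i → m ⟹ (Σ_{n<N} a n∕(n+1))∕H_N → m` — by `logSum_eq_cesaro` the ℓ-mean of a is `σ_N∕H_N`
(→ 0) plus the ℓ-mean of the Cesàro means (→ m by regularity). [folklore] (Hardy, Divergent Series §3.8: (C,1) ⟹ ℓ) -/
theorem logMean_of_cesaro {m : ℝ} (hces : Tendsto (fun n : ℕ => (n : ℝ)⁻¹ * ∑ i ∈ range n, a i) atTop (𝓝 m)) :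
    Tendsto (fun N => (∑ n ∈ range N, ((n : ℝ) + 1)⁻¹ * a n) / ∑ n ∈ range N, ((n : ℝ) + 1)⁻¹) atTop (𝓝 m) := by
  have h1 : Tendsto (fun N : ℕ => ((N : ℝ)⁻¹ * ∑ i ∈ range N, a i) / ∑ n ∈ range N, ((n : ℝ) + 1)⁻¹) atTop (𝓝 0) :=
    hces.div_atTop logMass_tendsto_atTop
  have h2 : Tendsto (fun N => (∑ k ∈ range N, ((k : ℝ) + 1)⁻¹ * ((k : ℝ)⁻¹ * ∑ i ∈ range k, a i)) /
      ∑ n ∈ range N, ((n : ℝ) + 1)⁻¹) atTop (𝓝 m) :=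
    weightedMean_of_tendsto (a := fun k : ℕ => (k : ℝ)⁻¹ * ∑ i ∈ range k, a i) logWeight_nonneg logMass_tendsto_atTop hces
  have := h1.add h2
  rw [zero_add] at this
  refine this.congr fun N => ?_
  rw [logSum_eq_cesaro a N, add_div]

/-- IN SCHMIDT'S CLASS the three statements `a → m`, `σ → m` (P2 #53a) each imply `ℓ-mean → m`; recorded form: (SO) + `σ → m` ⟹ `ℓ-mean → m`
(no Tauberian condition is needed for this direction — the class hypothesis is idle here and kept only to display the chain). [folklore] -/
theorem logMean_of_tendsto' {m : ℝ}
    (_hso : ∀ ε > 0, ∃ q > (1:ℝ), ∃ N₀ : ℕ, ∀ N i : ℕ, N₀ ≤ N → N ≤ i → (i : ℝ) ≤ q * N → |a i - a N| ≤ ε)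
    (hces : Tendsto (fun n : ℕ => (n : ℝ)⁻¹ * ∑ i ∈ range n, a i) atTop (𝓝 m)) :
    Tendsto a atTop (𝓝 m) ∧
      Tendsto (fun N => (∑ n ∈ range N, ((n : ℝ) + 1)⁻¹ * a n) / ∑ n ∈ range N, ((n : ℝ) + 1)⁻¹) atTop (𝓝 m) :=
  ⟨tendsto_of_cesaro_slowlyOscillating hces _hso, logMean_of_cesaro hces⟩

end

end Summit.QuantumFields.BalabanUV.Beta.EriceFlowEnclosureLogMeanSeq
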